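import Summits.CriticalPhenomena.PercolationContinuityZ3.Theorems.PercNearOneGluingNoHeavyLowerTailSahiHittingExchangeableSix
import Summits.CriticalPhenomena.PercolationContinuityZ3.Theorems.PercNearOneGluingNoHeavyLowerTailSahiHittingMoments
import HarnessLib

/-!
# `NoHeavyLowerTail` (stmt-CriticalPhenomena-4575) — Sahi's `C₆` for EXCHANGEABLE HITTING FAMILIES on product spaces (model form)

Support file, seat `prim-l12-p5` (gen 8), `--supports stmt-CriticalPhenomena-4575`.  No definitions, no named facts, no sorries; computational axioms inherited from
the kernel certificate `exch6_check` of `…SahiHittingExchangeableSix` (175 218 169 tensor-Bernstein profiles).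

Model form of `sahiE_six_nonneg_of_exchangeableBoolean_moments`: six finite sets `A_0,…,A_5 ⊆ ι`, product weight `bernoulliWeight p`, and EXCHANGEABLE MISS
PROBABILITIES in Boolean-model form — the probability that `r` given sets are all missed is `∏_s w_s^{C(6,s)−C(6−r,s)}` for layer weights `w ∈ [0,1]^6`
(`w_s` = product of the silent probabilities of the coins lying in exactly `s` of the sets).  The mixed moments are read off by inclusion–exclusion
(`ex_prod_ind_hit`, `Finset.sum_powerset_apply_card`), exactly as in the order-5 companion `…SahiHittingExchangeableFiveModel`.

* **`prodBernoulli_sahiE_hit_six_nonneg_of_exchangeable`**: `0 ≤ E_6(1_{H_{A_0}},…,1_{H_{A_5}})` for every such family. [this work]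
-/

namespace Summit.CriticalPhenomena.PercolationContinuityZ3.Theorems

namespace SahiHitting

open Finset Literature.Combinatorics.Sahi2008
open Literature.Probability.Percolation.DecisionTree (ind ind_of_mem ind_of_not_mem ind_nonneg)

variable {ι : Type*} [Fintype ι] [DecidableEq ι]

/-- Mixed moments of an exchangeable hitting family of six sets: if the miss probability of any `r` of the sets is `F r`, then
`E(∏_{j∈B} 1_{H_{A_j}}) = Σ_{r ≤ |B|} C(|B|,r)·(−1)^r F(r)`. [this work] -/
theorem ex_prod_ind_hit_of_exchangeable_six (p : ι → unitInterval) (A : Fin 6 → Finset ι) (F : ℕ → ℝ)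
    (hexch : ∀ R : Finset (Fin 6), ∏ c ∈ R.biUnion A, (1 - (p c : ℝ)) = F R.card) (B : Finset (Fin 6)) :
    ex (bernoulliWeight p) (∏ j ∈ B, ind {ω : Set ι | ∃ a ∈ A j, a ∈ ω})
      = ∑ m ∈ Finset.range (B.card + 1), (B.card.choose m) • ((-1 : ℝ) ^ m * F m) := by
  rw [ex_prod_ind_hit]
  have h : ∀ R ∈ B.powerset, (-1 : ℝ) ^ R.card * ∏ c ∈ R.biUnion A, (1 - (p c : ℝ)) = (-1 : ℝ) ^ R.card * F R.card :=
    fun R _ => by rw [hexch R]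
  rw [Finset.sum_congr rfl h]
  exact Finset.sum_powerset_apply_card (fun n : ℕ => (-1 : ℝ) ^ n * F n)

set_option maxHeartbeats 4000000 in
/-- **Sahi's `C₆` for exchangeable hitting families (model form).**  Product weight on `2^ι`; six finite sets `A_0,…,A_5` whose miss probabilities are
exchangeable in Boolean-model form: for every `R ⊆ {0,…,5}`, `∏_{c ∈ ⋃_{j∈R} A_j} (1 − p_c) = ∏_{s<6} w_s^{C(6,s+1) − C(6−|R|,s+1)}` with `w ∈ [0,1]^6`.
Then `0 ≤ E_6(1_{H_{A_0}},…,1_{H_{A_5}})`. [this work; cite: Sahi2008, Conj. 5; LiebSahi2021, Conj. 1.1] -/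
theorem prodBernoulli_sahiE_hit_six_nonneg_of_exchangeable (p : ι → unitInterval) (A : Fin 6 → Finset ι) (w : Fin 6 → ℝ)
    (hw : ∀ s, 0 ≤ w s ∧ w s ≤ 1)
    (hexch : ∀ R : Finset (Fin 6), ∏ c ∈ R.biUnion A, (1 - (p c : ℝ)) = ∏ s : Fin 6, w s ^ (Nat.choose 6 (s.1 + 1) - Nat.choose (6 - R.card) (s.1 + 1))) :
    0 ≤ sahiE (bernoulliWeight p) 6 (fun l => ind {ω : Set ι | ∃ a ∈ A l, a ∈ ω}) := by
  set f : Fin 6 → Set ι → ℝ := fun l => ind {ω : Set ι | ∃ a ∈ A l, a ∈ ω} with hf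
  set F : ℕ → ℝ := fun r => ∏ s : Fin 6, w s ^ (Nat.choose 6 (s.1 + 1) - Nat.choose (6 - r) (s.1 + 1)) with hF
  have key : ∀ B : Finset (Fin 6), ex (bernoulliWeight p) (∏ j ∈ B, f j)
      = ∑ m ∈ Finset.range (B.card + 1), (B.card.choose m) • ((-1 : ℝ) ^ m * F m) :=
    fun B => ex_prod_ind_hit_of_exchangeable_six p A F (fun R => hexch R) B
  have hF0 : F 0 = 1 := by simp [hF]
  have hF1 : F 1 = w 0 * w 1 ^ 5 * w 2 ^ 10 * w 3 ^ 10 * w 4 ^ 5 * w 5 := by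
    simp only [hF, Fin.prod_univ_six]; norm_num [Nat.choose]
  have hF2 : F 2 = w 0 ^ 2 * w 1 ^ 9 * w 2 ^ 16 * w 3 ^ 14 * w 4 ^ 6 * w 5 := by
    simp only [hF, Fin.prod_univ_six]; norm_num [Nat.choose]
  have hF3 : F 3 = w 0 ^ 3 * w 1 ^ 12 * w 2 ^ 19 * w 3 ^ 15 * w 4 ^ 6 * w 5 := by
    simp only [hF, Fin.prod_univ_six]; norm_num [Nat.choose]
  have hF4 : F 4 = w 0 ^ 4 * w 1 ^ 14 * w 2 ^ 20 * w 3 ^ 15 * w 4 ^ 6 * w 5 := by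
    simp only [hF, Fin.prod_univ_six]; norm_num [Nat.choose]
  have hF5 : F 5 = w 0 ^ 5 * w 1 ^ 15 * w 2 ^ 20 * w 3 ^ 15 * w 4 ^ 6 * w 5 := by
    simp only [hF, Fin.prod_univ_six]; norm_num [Nat.choose]
  have hF6 : F 6 = w 0 ^ 6 * w 1 ^ 15 * w 2 ^ 20 * w 3 ^ 15 * w 4 ^ 6 * w 5 := by
    simp only [hF, Fin.prod_univ_six]; norm_num [Nat.choose]
  refine sahiE_six_nonneg_of_exchangeableBoolean_moments (bernoulliWeight p) f w hw ?_ ?_ ?_ ?_ ?_ ?_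
  · intro i
    have e : f i = ∏ j ∈ ({i} : Finset (Fin 6)), f j := by rw [Finset.prod_singleton]
    rw [e, key, Finset.card_singleton]
    simp only [Finset.sum_range_succ, Finset.sum_range_zero, hF0, hF1]
    norm_num [Nat.choose]; ring
  · intro i j hij
    have hi : i ∉ ({j} : Finset (Fin 6)) := by
      rw [Finset.mem_singleton]; exact ne_of_lt hij
    have e : f i * f j = ∏ l ∈ ({i, j} : Finset (Fin 6)), f l := by
      rw [Finset.prod_insert hi, Finset.prod_singleton]
    have hc : ({i, j} : Finset (Fin 6)).card = 2 := by
      rw [Finset.card_insert_of_notMem hi, Finset.card_singleton]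
    rw [e, key, hc]
    simp only [Finset.sum_range_succ, Finset.sum_range_zero, hF0, hF1, hF2]
    norm_num [Nat.choose]; ring
  · intro i j k hij hjk
    have hj : j ∉ ({k} : Finset (Fin 6)) := by
      rw [Finset.mem_singleton]; exact ne_of_lt hjk
    have hi : i ∉ ({j, k} : Finset (Fin 6)) := by
      simp only [Finset.mem_insert, Finset.mem_singleton, not_or]
      exact ⟨ne_of_lt hij, ne_of_lt (hij.trans hjk)⟩
    have e : f i * f j * f k = ∏ l ∈ ({i, j, k} : Finset (Fin 6)), f l := by
      rw [Finset.prod_insert hi, Finset.prod_insert hj, Finset.prod_singleton, mul_assoc]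
    have hc : ({i, j, k} : Finset (Fin 6)).card = 3 := by
      rw [Finset.card_insert_of_notMem hi, Finset.card_insert_of_notMem hj, Finset.card_singleton]
    rw [e, key, hc]
    simp only [Finset.sum_range_succ, Finset.sum_range_zero, hF0, hF1, hF2, hF3]
    norm_num [Nat.choose]; ring
  · intro i j k l hij hjk hkl
    have hk : k ∉ ({l} : Finset (Fin 6)) := by
      rw [Finset.mem_singleton]; exact ne_of_lt hkl
    have hj : j ∉ ({k, l} : Finset (Fin 6)) := by
      simp only [Finset.mem_insert, Finset.mem_singleton, not_or]
      exact ⟨ne_of_lt hjk, ne_of_lt (hjk.trans hkl)⟩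
    have hi : i ∉ ({j, k, l} : Finset (Fin 6)) := by
      simp only [Finset.mem_insert, Finset.mem_singleton, not_or]
      exact ⟨ne_of_lt hij, ne_of_lt (hij.trans hjk), ne_of_lt ((hij.trans hjk).trans hkl)⟩
    have e : f i * f j * f k * f l = ∏ x ∈ ({i, j, k, l} : Finset (Fin 6)), f x := by
      rw [Finset.prod_insert hi, Finset.prod_insert hj, Finset.prod_insert hk, Finset.prod_singleton]; ring
    have hc : ({i, j, k, l} : Finset (Fin 6)).card = 4 := by
      rw [Finset.card_insert_of_notMem hi, Finset.card_insert_of_notMem hj, Finset.card_insert_of_notMem hk, Finset.card_singleton]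
    rw [e, key, hc]
    simp only [Finset.sum_range_succ, Finset.sum_range_zero, hF0, hF1, hF2, hF3, hF4]
    norm_num [Nat.choose]; ring
  · intro i j k l r hij hjk hkl hlr
    have hl : l ∉ ({r} : Finset (Fin 6)) := by
      rw [Finset.mem_singleton]; exact ne_of_lt hlr
    have hk : k ∉ ({l, r} : Finset (Fin 6)) := by
      simp only [Finset.mem_insert, Finset.mem_singleton, not_or]
      exact ⟨ne_of_lt hkl, ne_of_lt (hkl.trans hlr)⟩
    have hj : j ∉ ({k, l, r} : Finset (Fin 6)) := by
      simp only [Finset.mem_insert, Finset.mem_singleton, not_or]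
      exact ⟨ne_of_lt hjk, ne_of_lt (hjk.trans hkl), ne_of_lt ((hjk.trans hkl).trans hlr)⟩
    have hi : i ∉ ({j, k, l, r} : Finset (Fin 6)) := by
      simp only [Finset.mem_insert, Finset.mem_singleton, not_or]
      exact ⟨ne_of_lt hij, ne_of_lt (hij.trans hjk), ne_of_lt ((hij.trans hjk).trans hkl),
        ne_of_lt (((hij.trans hjk).trans hkl).trans hlr)⟩
    have e : f i * f j * f k * f l * f r = ∏ x ∈ ({i, j, k, l, r} : Finset (Fin 6)), f x := by
      rw [Finset.prod_insert hi, Finset.prod_insert hj, Finset.prod_insert hk, Finset.prod_insert hl, Finset.prod_singleton]; ring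
    have hc : ({i, j, k, l, r} : Finset (Fin 6)).card = 5 := by
      rw [Finset.card_insert_of_notMem hi, Finset.card_insert_of_notMem hj, Finset.card_insert_of_notMem hk,
        Finset.card_insert_of_notMem hl, Finset.card_singleton]
    rw [e, key, hc]
    simp only [Finset.sum_range_succ, Finset.sum_range_zero, hF0, hF1, hF2, hF3, hF4, hF5]
    norm_num [Nat.choose]; ring
  · have e : f 0 * f 1 * f 2 * f 3 * f 4 * f 5 = ∏ x ∈ (Finset.univ : Finset (Fin 6)), f x := by
      rw [Fin.prod_univ_six]
    have hc : (Finset.univ : Finset (Fin 6)).card = 6 := by simp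
    rw [e, key, hc]
    simp only [Finset.sum_range_succ, Finset.sum_range_zero, hF0, hF1, hF2, hF3, hF4, hF5, hF6]
    norm_num [Nat.choose]; ring

end SahiHitting

end Summit.CriticalPhenomena.PercolationContinuityZ3.Theorems
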